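import Literature.AlgebraicGeometry.HodgeTheory.FermatLinearSubspaceComplexPoints
import Literature.AlgebraicGeometry.HodgeTheory.ThomGysinClosedImmersion
import Literature.AlgebraicGeometry.HodgeTheory.HyperplaneClassRestrictionNonzero
import Literature.AlgebraicGeometry.HodgeTheory.HolomorphicBundleChernCharacterProjectiveSpace
import Literature.AlgebraicGeometry.HodgeTheory.FermatEigenspaceRestriction
import Literature.AlgebraicGeometry.HodgeTheory.TopDegreeClasses
import Literature.AlgebraicGeometry.HodgeTheory.FermatAffineChart
import Literature.AlgebraicGeometry.CubicSurfaces.FermatCubicLines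
import Literature.AlgebraicTopology.SingularHomology.CohomologyVanishingNearUnion
import Literature.AlgebraicTopology.SingularHomology.CompactGroupExteriorCohomology
import Mathlib.RingTheory.RootsOfUnity.Complex
import HarnessLib

/-!
# The classes of the 27 lines on the Fermat cubic surface: restriction to a second line

Family `hodge`, layer `Literature/AlgebraicGeometry/HodgeTheory`. For the Fermat cubic surface
`X = X²₃ = V₊(x₀³ + x₁³ + x₂³ + x₃³) ⊂ ℙ³_ℂ` (`fermatHypersurface (2 * 1) 3`) and its 27 lines
`ℓ_{p,α,β} : x₀ = α x_J, x_K = β x_L` (`{0,J} ⊔ {K,L} = {0,1,2,3}` one of the three systems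
`p ∈ Sys` of `CubicSurfaces/FermatCubicLines`, `α, β ∈ {-1, -ω, -ω²}` the cube roots of `-1`;
Hartshorne V Ex. 4.16), realised as Shioda–Aoki linear subspaces `L_{σ_p,ε}`
(`linearSubspaceEmb`, `fermatLinearSubspaceClass` of `FermatLinearSubspaceClass`: the Gysin
images `cl(ℓ) = g_* 1 ∈ H²(X(ℂ); ℂ)`), this file computes the RESTRICTIONS `g_{ℓ'}^* cl(ℓ)` of the
line classes to other lines `ℓ'`, which is what the intersection numbers `ℓ · ℓ' ∈ {0, 1}` of
skew/meeting lines mean cohomologically (`∫_{ℓ'} g_{ℓ'}^* cl(ℓ) = ℓ · ℓ'`):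

* `map_lineEmb_lineClass_eq_zero` — **`g_{ℓ'}^* cl(ℓ) = 0` for SKEW lines** (the class of `ℓ`
  dies off `ℓ` — Gysin images are supported on the image, the tree's
  `iSup_range_complexGysin_le_ker_restrictCompl'` — and `ℓ'(ℂ) ∩ ℓ(ℂ) = ∅`);
* `map_lineEmb_lineClass_ne_zero` — **`g_{ℓ'}^* cl(ℓ) ≠ 0` for the MEETING lines
  `ℓ = ℓ_{p,α,β}`, `ℓ' = ℓ_{p,α',β}` (`α' ≠ α`)**. Printed proof (Hartshorne V Prop. 1.4 and
  Thm. 4.9 / Ex. 4.16: `ℓ · ℓ' = 1` for meeting lines, `h = ℓ + ℓ₁ + ℓ₂` for a tritangent plane)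
  read cohomologically and WITHOUT local intersection multiplicities: the tritangent (Eckardt)
  plane `Π : x₀ = α x_J` cuts `X` in the three concurrent lines `ℓ_b = ℓ_{p,α,β_b}`
  (`β_b³ = -1`), so a hyperplane-type class `h' = ι'^* r₀` of `X` for the projective embedding
  `ι' = (X ↪ ℙ³ ↪ ℙ⁴)`, `[x] ↦ [x₀ - α x_J : x₀ : ⋯ : x₃]` (a closed immersion, `linSubstMap`),
  DIES off `Π ∩ X = ⋃_b ℓ_b` (it is restricted from `ℙ⁴` and `X ∖ Π` lies over the affine chart
  `{y₀ ≠ 0}`: `restrictCompl_map_eq_zero_of_stdChartSource`); by the Thom–Gysin sequence for the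
  three lines (Deligne, Hodge III, Cor. 8.2.8 ⊆, the tree's
  `ker_restrictCompl_le_iSup_range_complexGysin_of_pullback`, whose hypothesis — Prop. 8.2.7 in
  Čech form — is VERIFIED here for concurrent curves: tautness of each line,
  `exists_isOpen_map_subsetIncl_eq_zero_of_isClosedImmersion`, patched across a small acyclic
  ball at the Eckardt point, `singularCohomology.exists_isOpen_union_map_subsetIncl_eq_zero`)
  `h' = Σ_b s_b cl(ℓ_b)`; restricting to `ℓ'`, which misses `ℓ_b` for `β_b ≠ β`, gives
  `g_{ℓ'}^* h' = s_β g_{ℓ'}^* cl(ℓ)`, and `g_{ℓ'}^* h' = (ℓ' ↪ ℙ⁴)^* r₀ ≠ 0`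
  (`complexBetti_map_two_ne_zero_of_isClosedImmersion`: the restriction of a non-zero class of
  `H²(ℙᴺ)` to a positive-dimensional smooth closed subvariety is non-zero).

Also: the dictionaries `pt_mem_range_lineEmb_iff` (complex points of `ℓ_{p,α,β}` ↔ vectors of
`fermatPlane ℂ p α β`), the Eckardt point, and `hypothesisH_of_concurrent` (Prop. 8.2.7 in Čech
form for three closed immersions whose images pairwise meet in one common complex point).
Small definitions: `ω₃`, `sysPerm`, `sysEps`, `lineEmb`, `lineClass`, `planeSubst`; no named facts.

## References

* [Hartshorne1977] R. Hartshorne, Algebraic Geometry (1977), V Ex. 4.16, V Prop. 1.4, V Thm. 4.9,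
  II Ex. 3.12, II Example 7.1.1.
* [Shioda1979HodgeFermat] T. Shioda, Math. Ann. 245 (1979), §1. [Aoki1987] N. Aoki, Thm. 1-1.
* [DeligneHodgeIII1974] P. Deligne, Théorie de Hodge III, Prop. 8.2.7, Cor. 8.2.8.
* [VoisinHodgeI2002] C. Voisin, Hodge Theory I, §7.1.2, §11.1.2. [HatcherAT2002] §3.1 pp. 203–204.
-/

noncomputable section

open scoped LinearAlgebra.Projectivization
open CategoryTheory AlgebraicGeometry MvPolynomial
open Literature.AlgebraicGeometry.Motives Literature.AlgebraicTopology.SingularHomology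
open Literature.NumberTheory.Transcendental
open Literature.AlgebraicGeometry.CubicSurfaces Literature.AlgebraicGeometry.CubicSurfaces.CubicSurface

namespace Literature.AlgebraicGeometry.HodgeTheory

/-! ### Prop. 8.2.7 in Čech form for three concurrent closed subvarieties -/

section Concurrent

variable {n : ℕ} {X : Motives.SchemeOver ℂ}

/-- **Deligne's Prop. 8.2.7 in Čech form for three closed immersions whose images pairwise meet
in one common complex point.** For `X` smooth projective, closed immersions `g j : Y j ⟶ X`
(`j : Fin 3`) of smooth projective `Y j`, and a complex point `P₀` lying on all three images such
that any two images meet (on complex points) only in `P₀`: every class `x' ∈ H^{p+1}(X(ℂ); ℂ)`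
(`p ≠ 0`) killed by the three pull-backs `(g j)(ℂ)^*` vanishes on an open neighbourhood of
`⋃ j, g_j(Y j)(ℂ)`. Proof: tautness gives such a neighbourhood `V j` for each image separately
(`exists_isOpen_map_subsetIncl_eq_zero_of_isClosedImmersion`); patch `V 0`, `V 1` across a small
acyclic ball around `P₀` inside `V 0 ∩ V 1`, then the result with `V 2`
(`singularCohomology.exists_isOpen_union_map_subsetIncl_eq_zero`, Mayer–Vietoris).
[cite: DeligneHodgeIII1974, Prop. 8.2.7] [cite: HatcherAT2002, §3.1 pp. 203–204] -/
theorem hypothesisH_of_concurrent (hX : Motives.IsSmoothProjective n X) {m : ℕ}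
    {Y : Fin 3 → Motives.SchemeOver ℂ} (hY : ∀ j, Motives.IsSmoothProjective m (Y j))
    (g : ∀ j, Y j ⟶ X) [∀ j, IsClosedImmersion (g j).left] (P₀ : Motives.ComplexPoints X)
    (hP₀ : ∀ j, P₀.pt ∈ Set.range (g j).left.base)
    (hmeet : ∀ i j, i ≠ j → ∀ P : Motives.ComplexPoints X,
      P.pt ∈ Set.range (g i).left.base → P.pt ∈ Set.range (g j).left.base → P = P₀)
    {p : ℕ} (hp : p ≠ 0) (x' : complexBetti X (p + 1))
    (hx' : ∀ j, complexBetti.map (g j) (p + 1) x' = 0) :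
    ∃ V : Set (Motives.ComplexPoints X), IsOpen V ∧
      {P | P.pt ∈ ⋃ j, Set.range (g j).left.base} ⊆ V ∧
      singularCohomology.map ℂ ℂ (subsetIncl V) (p + 1) x' = 0 := by
  letI := hX.chartedSpace
  haveI := Motives.ComplexPoints.compactSpace_of_isSmoothProjective hX
  haveI := Motives.ComplexPoints.t2Space_of_isSmoothProjective hX
  -- tautness of each image
  have hV : ∀ j, ∃ V : Set (Motives.ComplexPoints X), IsOpen V ∧
      {P | P.pt ∈ Set.range (g j).left.base} ⊆ V ∧
      singularCohomology.map ℂ ℂ (subsetIncl V) (p + 1) x' = 0 :=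
    fun j ↦ exists_isOpen_map_subsetIncl_eq_zero_of_isClosedImmersion hX (hY j) (g j) x' (hx' j)
  choose V hVo hKV hVx using hV
  set K : Fin 3 → Set (Motives.ComplexPoints X) := fun j ↦ {P | P.pt ∈ Set.range (g j).left.base}
    with hK
  have hKc : ∀ j, IsCompact (K j) :=
    fun j ↦ (isClosed_setOf_pt_mem (g j).left.isClosedEmbedding.isClosed_range).isCompact
  have hPK : ∀ j, P₀ ∈ K j := hP₀
  have hKK : ∀ i j, i ≠ j → K i ∩ K j ⊆ {P₀} :=
    fun i j hij P hP ↦ Set.mem_singleton_iff.mpr (hmeet i j hij P hP.1 hP.2)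
  -- patch `V 0` and `V 1`
  obtain ⟨B, hBo, hPB, hBV, hBZ⟩ := singularCohomology.exists_isOpen_subset_isZero_of_chartedSpace
    (R := ℂ) (d := 2 * n) P₀ (U := V 0 ∩ V 1)
    (((hVo 0).inter (hVo 1)).mem_nhds ⟨hKV 0 (hPK 0), hKV 1 (hPK 1)⟩) hp
  obtain ⟨W, hWo, hKW, hWx⟩ := singularCohomology.exists_isOpen_union_map_subsetIncl_eq_zero ℂ
    (hKc 0) (hKc 1) (hKK 0 1 (by decide)) x' (hVo 0) (hVo 1) (hKV 0) (hKV 1) (hVx 0) (hVx 1)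
    hBo hPB hBV hBZ
  -- patch `W ⊇ K 0 ∪ K 1` and `V 2`
  have hKK' : (K 0 ∪ K 1) ∩ K 2 ⊆ {P₀} := by
    rintro P ⟨hP | hP, hP2⟩
    exacts [hKK 0 2 (by decide) ⟨hP, hP2⟩, hKK 1 2 (by decide) ⟨hP, hP2⟩]
  obtain ⟨B', hB'o, hPB', hB'V, hB'Z⟩ := singularCohomology.exists_isOpen_subset_isZero_of_chartedSpace
    (R := ℂ) (d := 2 * n) P₀ (U := W ∩ V 2)
    ((hWo.inter (hVo 2)).mem_nhds ⟨hKW (Or.inl (hPK 0)), hKV 2 (hPK 2)⟩) hp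
  obtain ⟨W', hW'o, hKW', hW'x⟩ := singularCohomology.exists_isOpen_union_map_subsetIncl_eq_zero ℂ
    ((hKc 0).union (hKc 1)) (hKc 2) hKK' x' hWo (hVo 2) hKW (hKV 2) hWx (hVx 2) hB'o hPB' hB'V hB'Z
  refine ⟨W', hW'o, fun P hP ↦ hKW' ?_, hW'x⟩
  simp only [Set.mem_setOf_eq, Set.mem_iUnion] at hP
  obtain ⟨j, hj⟩ := hP
  fin_cases j
  · exact Or.inl (Or.inl hj)
  · exact Or.inl (Or.inr hj)
  · exact Or.inr hj

end Concurrent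

/-! ### The cube roots of unity and of `-1` in `ℂ` -/

/-- A primitive cube root of unity `ω = e^{2πi/3} ∈ ℂ`. [folklore] -/
def ω₃ : ℂ := Complex.exp (2 * Real.pi * Complex.I / 3)

/-- `ω₃` is a primitive cube root of unity (Mathlib `Complex.isPrimitiveRoot_exp`). [folklore] -/
theorem isPrimitiveRoot_ω₃ : IsPrimitiveRoot ω₃ 3 := by
  have h := Complex.isPrimitiveRoot_exp 3 (by norm_num)
  rw [Nat.cast_ofNat] at h
  exact h

/-- `u³ + v³ = 0` in `ℂ` forces `u = (-ωᵉ) v` for some cube root `-ωᵉ` of `-1`. [folklore] -/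
theorem exists_eq_croot_mul_of_cube_add_cube_eq_zero {u v : ℂ} (h : u ^ 3 + v ^ 3 = 0) :
    ∃ e : ZMod 3, u = croot ω₃ e * v := by
  by_cases hv : v = 0
  · subst hv
    have hu : u = 0 := pow_eq_zero_iff (n := 3) (by norm_num) |>.mp (by simpa using h)
    exact ⟨0, by rw [hu, mul_zero]⟩
  · have ht : (u / v) ^ 3 = -1 := by
      rw [div_pow, div_eq_iff (pow_ne_zero 3 hv)]
      linear_combination h
    obtain ⟨e, he⟩ := exists_eq_croot isPrimitiveRoot_ω₃ ht
    exact ⟨e, by rw [← he, div_mul_cancel₀ u hv]⟩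

/-! ### The three systems as pairings of the coordinates -/

/-- The pairing `0 ↔ J`, `K ↔ L` of the four homogeneous coordinates attached to the system
`p` (`{0,J} ⊔ {K,L} = {0,1,2,3}`), a fixed-point-free involution. [cite: Hartshorne1977, V Ex. 4.16] -/
def sysPerm (p : Sys) : Equiv.Perm (Fin (2 * 1 + 2)) :=
  Equiv.swap 0 (sysJ p) * Equiv.swap (sysK p) (sysL p)

/-- `σ_p` has no fixed point. [folklore] -/
theorem sysPerm_ne (p : Sys) : ∀ i, sysPerm p i ≠ i := by
  cases p <;> decide

/-- `σ_p` is an involution. [folklore] -/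
theorem sysPerm_sysPerm (p : Sys) : ∀ i, sysPerm p (sysPerm p i) = i := by
  cases p <;> decide

/-- The smaller elements of the two orbits of `σ_p` are `0` and `K`. [folklore] -/
theorem lt_sysPerm_iff (p : Sys) (i : Fin (2 * 1 + 2)) : i < sysPerm p i ↔ i = 0 ∨ i = sysK p := by
  revert i
  cases p <;> decide

/-- `σ_p 0 = J`. [folklore] -/
theorem sysPerm_zero (p : Sys) : sysPerm p 0 = sysJ p := by
  cases p <;> decide

/-- `σ_p K = L`. [folklore] -/
theorem sysPerm_sysK (p : Sys) : sysPerm p (sysK p) = sysL p := by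
  cases p <;> decide

/-- The slope vector `ε` of the line `x₀ = α x_J, x_K = β x_L`: `ε₀ = α`, `ε_K = β` (the values at
the larger elements `J`, `L` are irrelevant and set to `1`). [cite: Hartshorne1977, V Ex. 4.16] -/
def sysEps (p : Sys) (α β : ℂ) : Fin (2 * 1 + 2) → ℂ :=
  fun i ↦ if i = 0 then α else if i = sysK p then β else 1

/-- `ε₀ = α`. [folklore] -/
@[simp] theorem sysEps_zero (p : Sys) (α β : ℂ) : sysEps p α β 0 = α := by
  simp [sysEps]

/-- `ε_K = β`. [folklore] -/
@[simp] theorem sysEps_sysK (p : Sys) (α β : ℂ) : sysEps p α β (sysK p) = β := by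
  have h : (sysK p : Fin (2 * 1 + 2)) ≠ 0 := by cases p <;> decide
  simp [sysEps, h]

/-- For cube roots `α, β` of `-1`, `εᵢ³ = -1` at the smaller elements. [folklore] -/
theorem sysEps_pow_three (p : Sys) {α β : ℂ} (hα : α ^ 3 = -1) (hβ : β ^ 3 = -1) :
    ∀ i, i < sysPerm p i → sysEps p α β i ^ 3 = -1 := by
  intro i hi
  rcases (lt_sysPerm_iff p i).mp hi with rfl | rfl
  · rwa [sysEps_zero]
  · rwa [sysEps_sysK]

/-- **The equations `xᵢ = εᵢ x_{σ_p i}` (`i < σ_p i`) of `L_{σ_p,ε}` are those of the plane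
`fermatPlane ℂ p α β = {x₀ = α x_J, x_K = β x_L}`** of `CubicSurfaces/FermatCubicLines`. [folklore] -/
theorem onLine_sysPerm_iff (p : Sys) (α β : ℂ) (z : Fin (2 * 1 + 2) → ℂ) :
    (∀ i, i < sysPerm p i → z i = sysEps p α β i * z (sysPerm p i)) ↔ z ∈ fermatPlane ℂ p α β := by
  change _ ↔ z 0 = α * z (sysJ p) ∧ z (sysK p) = β * z (sysL p)
  constructor
  · intro h
    refine ⟨?_, ?_⟩
    · have h0 := h 0 ((lt_sysPerm_iff p 0).mpr (Or.inl rfl))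
      rwa [sysPerm_zero, sysEps_zero] at h0
    · have hK := h (sysK p) ((lt_sysPerm_iff p _).mpr (Or.inr rfl))
      rwa [sysPerm_sysK, sysEps_sysK] at hK
  · rintro ⟨h0, hK⟩ i hi
    rcases (lt_sysPerm_iff p i).mp hi with rfl | rfl
    · rwa [sysPerm_zero, sysEps_zero]
    · rwa [sysPerm_sysK, sysEps_sysK]

/-! ### The lines `ℓ_{p,a,b}` of the Fermat cubic surface and their classes -/

section Lines

/-- Local notation: the Fermat cubic surface `X²₃ = V₊(Σ xᵢ³) ⊂ ℙ³`. -/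
local notation "X₃" => fermatHypersurface (2 * 1) 3
/-- Local notation: the closed immersion `X²₃ ↪ ℙ³`. -/
local notation "ιX" => SmoothHypersurface.hypersurfaceι (fermatPolynomial ℂ (2 * 1) 3)

/-- `X²₃` is smooth projective of dimension `2`. [cite: Hartshorne1977, I Ex. 5.5] -/
theorem isSmoothProjective_X₃ : Motives.IsSmoothProjective (2 * 1) X₃ :=
  isSmoothProjective_fermatHypersurface (n := 2 * 1) (by norm_num) (by norm_num)

/-- `ℙ¹` is smooth projective of dimension `1`. [folklore] -/
theorem isSmoothProjective_P1 : Motives.IsSmoothProjective 1 (Motives.projectiveSpace 1 ℂ) :=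
  Motives.isSmoothProjective_projectiveSpace_holds ℂ 1

/-- **The line `ℓ_{p,a,b} : x₀ = (-ωᵃ) x_J, x_K = (-ωᵇ) x_L` of the Fermat cubic surface, as an
embedding `ℙ¹_ℂ ⟶ X²₃`** — Shioda's linear subspace `L_{σ_p,ε}` (`linearSubspaceEmb`).
[cite: Hartshorne1977, V Ex. 4.16] [cite: Shioda1979HodgeFermat, §1] -/
def lineEmb (p : Sys) (a b : ZMod 3) : Motives.projectiveSpace 1 ℂ ⟶ X₃ :=
  linearSubspaceEmb 3 (sysPerm_ne p) (sysPerm_sysPerm p) (sysEps p (croot ω₃ a) (croot ω₃ b))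
    (sysEps_pow_three p (croot_pow_three isPrimitiveRoot_ω₃ a) (croot_pow_three isPrimitiveRoot_ω₃ b))

/-- `ℓ_{p,a,b} ↪ X²₃` is a closed immersion. [cite: Hartshorne1977, II Ex. 3.12] -/
instance isClosedImmersion_lineEmb_left (p : Sys) (a b : ZMod 3) :
    IsClosedImmersion (lineEmb p a b).left :=
  isClosedImmersion_linearSubspaceEmb_left _ _ _ _

variable (μ : OrientationFamily)

/-- **The class `cl(ℓ_{p,a,b}) = g_* 1 ∈ H²(X²₃(ℂ); ℂ)` of the line** (Shioda's
`fermatLinearSubspaceClass`, the Gysin image of `1 ∈ H⁰(ℙ¹(ℂ))` relative to the orientation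
family `μ`). [cite: Shioda1979HodgeFermat, §1] [cite: FultonYoungTableaux1997, Appendix B §B.1 (5)] -/
def lineClass (p : Sys) (a b : ZMod 3) : complexBetti X₃ (2 * 1) :=
  fermatLinearSubspaceClass 3 μ (sysPerm_ne p) (sysPerm_sysPerm p) (sysEps p (croot ω₃ a) (croot ω₃ b))
    (sysEps_pow_three p (croot_pow_three isPrimitiveRoot_ω₃ a) (croot_pow_three isPrimitiveRoot_ω₃ b))
    le_rfl (by norm_num)

/-- `cl(ℓ) = g_* 1` (unfolding). [folklore] -/
theorem lineClass_eq (p : Sys) (a b : ZMod 3) :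
    lineClass μ p a b = complexGysin μ isSmoothProjective_P1 isSmoothProjective_X₃ (lineEmb p a b)
      (show 0 + 2 * (2 * 1) = 2 * 1 + 2 * 1 by ring)
      (singularCohomology.one ℂ (Motives.ComplexPoints (Motives.projectiveSpace 1 ℂ))) :=
  rfl

/-- For a submodule `W`, the chosen representative of `[v]` lies in `W` iff `v` does. [folklore] -/
theorem rep_mk_mem_iff {V : Type*} [AddCommGroup V] [Module ℂ V] (W : Submodule ℂ V) (v : V)
    (hv : v ≠ 0) : (Projectivization.mk ℂ v hv).rep ∈ W ↔ v ∈ W := by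
  obtain ⟨c, hc⟩ := Projectivization.exists_smul_eq_mk_rep ℂ v hv
  rw [← hc]
  refine ⟨fun h ↦ ?_, fun h ↦ W.smul_mem (c : ℂ) h⟩
  have h' : ((c⁻¹ : ℂˣ) : ℂ) • ((c : ℂ) • v) ∈ W := W.smul_mem _ h
  rwa [smul_smul, Units.inv_mul, one_smul] at h'

/-- **The complex points of `ℓ_{p,a,b}` are the points of `X²₃` whose homogeneous coordinates lie
in the plane `fermatPlane ℂ p (-ωᵃ) (-ωᵇ) = {x₀ = -ωᵃ x_J, x_K = -ωᵇ x_L}`.**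
[cite: Hartshorne1977, V Ex. 4.16] -/
theorem pt_mem_range_lineEmb_iff (p : Sys) (a b : ZMod 3) (P : Motives.ComplexPoints X₃) :
    P.pt ∈ Set.range (lineEmb p a b).left.base ↔
      (hypersurfacePoint ιX P).rep ∈ fermatPlane ℂ p (croot ω₃ a) (croot ω₃ b) := by
  rw [lineEmb, pt_mem_range_linearSubspaceEmb_iff _ _ _ _ P (Projectivization.rep_nonzero _)
    (Projectivization.mk_rep _).symm, onLine_sysPerm_iff]

/-- Coordinate form: if `[z]` are the coordinates of `P`, then `P ∈ ℓ_{p,a,b}` iff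
`z ∈ fermatPlane ℂ p (-ωᵃ) (-ωᵇ)`. [cite: Hartshorne1977, V Ex. 4.16] -/
theorem pt_mem_range_lineEmb_iff_of_eq_mk (p : Sys) (a b : ZMod 3) (P : Motives.ComplexPoints X₃)
    {z : Fin (2 * 1 + 2) → ℂ} (hz : z ≠ 0) (hP : hypersurfacePoint ιX P = Projectivization.mk ℂ z hz) :
    P.pt ∈ Set.range (lineEmb p a b).left.base ↔ z ∈ fermatPlane ℂ p (croot ω₃ a) (croot ω₃ b) := by
  rw [pt_mem_range_lineEmb_iff, hP, rep_mk_mem_iff]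

/-! ### Skew lines: `g_{ℓ'}^* cl(ℓ) = 0` -/

/-- The class of a line dies off the line. [cite: DeligneHodgeIII1974, Cor. 8.2.8] -/
theorem restrictCompl_range_lineClass (p : Sys) (a b : ZMod 3) :
    complexBetti.restrictCompl X₃ (Set.range (lineEmb p a b).left.base) (2 * 1) (lineClass μ p a b) = 0 := by
  have key := iSup_range_complexGysin_le_ker_restrictCompl' μ isSmoothProjective_X₃ (ι := Unit)
    (m := fun _ ↦ 1) (Y := fun _ ↦ Motives.projectiveSpace 1 ℂ) (fun _ ↦ isSmoothProjective_P1)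
    (fun _ ↦ lineEmb p a b) (2 * 1)
  have hmem : lineClass μ p a b ∈ LinearMap.ker (complexBetti.restrictCompl X₃
      (⋃ _ : Unit, Set.range (lineEmb p a b).left.base) (2 * 1)).hom :=
    key (Submodule.mem_iSup_of_mem () (Submodule.mem_iSup_of_mem 0
      (Submodule.mem_iSup_of_mem (show 0 + 2 * (2 * 1) = 2 * 1 + 2 * 1 by ring) ⟨_, rfl⟩)))
  rw [Set.iUnion_const] at hmem
  exact LinearMap.mem_ker.mp hmem

/-- **Skew lines: `g_{ℓ'}^* cl(ℓ) = 0`** when the planes of homogeneous coordinate vectors of `ℓ`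
and `ℓ'` meet trivially (`ℓ(ℂ) ∩ ℓ'(ℂ) = ∅`): the class of `ℓ` dies off `ℓ`, and `ℓ'` avoids `ℓ`.
(`ℓ · ℓ' = 0` for skew lines, Hartshorne V Thm. 4.9 / Ex. 4.16.) [cite: Hartshorne1977, V Ex. 4.16] -/
theorem map_lineEmb_lineClass_eq_zero {p q : Sys} {a b a' b' : ZMod 3}
    (h : fermatPlane ℂ p (croot ω₃ a) (croot ω₃ b) ⊓ fermatPlane ℂ q (croot ω₃ a') (croot ω₃ b') = ⊥) :
    complexBetti.map (lineEmb q a' b') (2 * 1) (lineClass μ p a b) = 0 := by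
  refine complexBetti_map_eq_zero_of_restrictCompl_eq_zero (lineEmb q a' b')
    (S := Set.range (lineEmb p a b).left.base) (fun Q hQ ↦ ?_) (restrictCompl_range_lineClass μ p a b)
  have hq : (Motives.AlgPoints.map (lineEmb q a' b') Q).pt ∈ Set.range (lineEmb q a' b').left.base :=
    ⟨Q.pt, rfl⟩
  rw [pt_mem_range_lineEmb_iff] at hQ hq
  have hmem : (hypersurfacePoint ιX (Motives.AlgPoints.map (lineEmb q a' b') Q)).rep ∈
      fermatPlane ℂ p (croot ω₃ a) (croot ω₃ b) ⊓ fermatPlane ℂ q (croot ω₃ a') (croot ω₃ b') :=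
    ⟨hQ, hq⟩
  rw [h, Submodule.mem_bot] at hmem
  exact Projectivization.rep_nonzero _ hmem

/-! ### The Eckardt point of the tritangent plane `x₀ = α x_J` -/

/-- The numbering of the smaller elements of `σ_p`: `e 0 = 0`. [folklore] -/
theorem orderEmbOfFin_sysPerm_zero (p : Sys) :
    Finset.orderEmbOfFin _ (card_filter_lt_perm (sysPerm_ne p) (sysPerm_sysPerm p)) 0 = 0 := by
  have hcard := card_filter_lt_perm (sysPerm_ne p) (sysPerm_sysPerm p)
  obtain ⟨j, hj⟩ : (0 : Fin (2 * 1 + 2)) ∈ Set.range (Finset.orderEmbOfFin _ hcard) := by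
    rw [Finset.range_orderEmbOfFin, Finset.mem_coe]
    simpa using (lt_sysPerm_iff p 0).mpr (Or.inl rfl)
  exact le_antisymm (((Finset.orderEmbOfFin _ hcard).monotone (Fin.zero_le j)).trans hj.le)
    (Fin.zero_le _)

/-- `[0] = 0`: the orbit of `0` is the first one. [folklore] -/
theorem pairOrbitIndex_sysPerm_zero (p : Sys) : pairOrbitIndex (sysPerm p) 0 = 0 := by
  have h := orderEmbOfFin_pairOrbitIndex (sysPerm_ne p) (sysPerm_sysPerm p)
    ((lt_sysPerm_iff p 0).mpr (Or.inl rfl))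
  conv_rhs at h => rw [← orderEmbOfFin_sysPerm_zero p]
  exact (Finset.orderEmbOfFin _ _).injective h

/-- `[K] = 1`: the orbit of `K` is the second one. [folklore] -/
theorem pairOrbitIndex_sysPerm_sysK (p : Sys) : pairOrbitIndex (sysPerm p) (sysK p) = 1 := by
  have hK := orderEmbOfFin_pairOrbitIndex (sysPerm_ne p) (sysPerm_sysPerm p)
    ((lt_sysPerm_iff p (sysK p)).mpr (Or.inr rfl))
  have hne : pairOrbitIndex (sysPerm p) (sysK p) ≠ 0 := by
    intro h0
    rw [h0, orderEmbOfFin_sysPerm_zero] at hK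
    revert hK
    cases p <;> decide
  exact Fin.eq_one_of_ne_zero _ hne

/-- The coordinates of `g_{p,α,β}([1 : 0])`: the vector `(α, 1, 0, 0)` permuted to the system
(`x₀ = α`, `x_J = 1`, `x_K = x_L = 0`) — the ECKARDT POINT of the plane `x₀ = α x_J`, common to the
three lines `ℓ_{p,α,β}`, `β³ = -1`. [cite: Hartshorne1977, V Ex. 4.16] -/
theorem aeval_pairedSubst_sysPerm_one_zero (p : Sys) (α β : ℂ) (i : Fin (2 * 1 + 2)) :
    aeval ![(1 : ℂ), 0] (pairedSubst (sysPerm p) (sysEps p α β) i) =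
      if i = 0 then α else if i = sysJ p then 1 else 0 := by
  by_cases hi : i < sysPerm p i
  · rw [aeval_pairedSubst_of_lt _ _ hi]
    rcases (lt_sysPerm_iff p i).mp hi with rfl | rfl
    · simp [pairOrbitIndex_sysPerm_zero]
    · have hK0 : (sysK p : Fin (2 * 1 + 2)) ≠ 0 := by cases p <;> decide
      have hKJ : (sysK p : Fin (2 * 1 + 2)) ≠ sysJ p := by cases p <;> decide
      simp [pairOrbitIndex_sysPerm_sysK, hK0, hKJ]
  · -- `i` is a larger element: `i = J` or `i = L`
    have hi' : i = sysJ p ∨ i = sysL p := by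
      revert i
      cases p <;> decide
    rcases hi' with rfl | rfl
    · have h := aeval_pairedSubst_perm (sysPerm_sysPerm p) (sysEps p α β) ![(1 : ℂ), 0]
        ((lt_sysPerm_iff p 0).mpr (Or.inl rfl))
      rw [sysPerm_zero, pairOrbitIndex_sysPerm_zero] at h
      have hJ0 : (sysJ p : Fin (2 * 1 + 2)) ≠ 0 := by cases p <;> decide
      simp [h, hJ0]
    · have h := aeval_pairedSubst_perm (sysPerm_sysPerm p) (sysEps p α β) ![(1 : ℂ), 0]
        ((lt_sysPerm_iff p (sysK p)).mpr (Or.inr rfl))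
      rw [sysPerm_sysK, pairOrbitIndex_sysPerm_sysK] at h
      have hL0 : (sysL p : Fin (2 * 1 + 2)) ≠ 0 := by cases p <;> decide
      have hLJ : (sysL p : Fin (2 * 1 + 2)) ≠ sysJ p := by cases p <;> decide
      simp [h, hL0, hLJ]

/-- The coordinate vector `(α at 0, 1 at J, 0 at K, L)` of the Eckardt point is non-zero. [folklore] -/
theorem eckardtVec_ne_zero (p : Sys) (α : ℂ) :
    (fun i : Fin (2 * 1 + 2) ↦ if i = 0 then α else if i = sysJ p then 1 else 0) ≠ 0 := by
  intro h
  have hJ := congr_fun h (sysJ p)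
  have hJ0 : (sysJ p : Fin (2 * 1 + 2)) ≠ 0 := by cases p <;> decide
  simp [hJ0] at hJ

/-- **The homogeneous coordinates of the Eckardt point `g_{p,a,b}([1 : 0])` are
`x₀ = -ωᵃ, x_J = 1, x_K = x_L = 0`** — independent of `b`. [cite: Hartshorne1977, V Ex. 4.16] -/
theorem hypersurfacePoint_eckardt (p : Sys) (a b : ZMod 3) :
    hypersurfacePoint ιX (Motives.AlgPoints.map (lineEmb p a b)
      (projPoint 1 (Projectivization.mk ℂ ![(1 : ℂ), 0] (by simp)))) =
      Projectivization.mk ℂ (fun i : Fin (2 * 1 + 2) ↦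
        if i = 0 then croot ω₃ a else if i = sysJ p then 1 else 0) (eckardtVec_ne_zero p _) := by
  rw [lineEmb, hypersurfacePoint_map_linearSubspaceEmb]
  exact (Projectivization.mk_eq_mk_iff' ℂ _ _ _ _).mpr
    ⟨1, by rw [one_smul]; exact funext fun i ↦ (aeval_pairedSubst_sysPerm_one_zero p _ _ i).symm⟩

/-- The three lines `ℓ_{p,a,b}` (`b ∈ ℤ/3`) pass through the same point `g_{p,a,b}([1 : 0])`.
[cite: Hartshorne1977, V Ex. 4.16] -/
theorem eckardt_eq (p : Sys) (a b b' : ZMod 3) :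
    Motives.AlgPoints.map (lineEmb p a b) (projPoint 1 (Projectivization.mk ℂ ![(1 : ℂ), 0] (by simp))) =
      Motives.AlgPoints.map (lineEmb p a b') (projPoint 1 (Projectivization.mk ℂ ![(1 : ℂ), 0] (by simp))) :=
  (isEmbedding_hypersurfacePoint ιX).injective (by rw [hypersurfacePoint_eckardt, hypersurfacePoint_eckardt])

/-- The Eckardt point lies on all three lines of its plane. [cite: Hartshorne1977, V Ex. 4.16] -/
theorem eckardt_pt_mem_range (p : Sys) (a b b' : ZMod 3) :
    (Motives.AlgPoints.map (lineEmb p a b)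
      (projPoint 1 (Projectivization.mk ℂ ![(1 : ℂ), 0] (by simp)))).pt ∈
      Set.range (lineEmb p a b').left.base := by
  rw [eckardt_eq p a b b']
  exact ⟨_, rfl⟩

/-- **The lines of the tritangent plane `x₀ = α x_J` are concurrent at the Eckardt point ONLY**: a
complex point lying on `ℓ_{p,a,b}` and on `ℓ_{p,a,b'}` with `b ≠ b'` is the point
`g_{p,a,b}([1 : 0])` with coordinates `x₀ = -ωᵃ, x_J = 1, x_K = x_L = 0`.
[cite: Hartshorne1977, V Ex. 4.16] -/
theorem eq_eckardt_of_mem_of_mem (p : Sys) (a : ZMod 3) {b b' : ZMod 3} (hbb : b ≠ b')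
    (P : Motives.ComplexPoints X₃) (hb : P.pt ∈ Set.range (lineEmb p a b).left.base)
    (hb' : P.pt ∈ Set.range (lineEmb p a b').left.base) :
    P = Motives.AlgPoints.map (lineEmb p a b)
      (projPoint 1 (Projectivization.mk ℂ ![(1 : ℂ), 0] (by simp))) := by
  rw [pt_mem_range_lineEmb_iff] at hb hb'
  set z := (hypersurfacePoint ιX P).rep with hz
  obtain ⟨h0, hK⟩ : z 0 = croot ω₃ a * z (sysJ p) ∧ z (sysK p) = croot ω₃ b * z (sysL p) := hb
  obtain ⟨-, hK'⟩ : z 0 = croot ω₃ a * z (sysJ p) ∧ z (sysK p) = croot ω₃ b' * z (sysL p) := hb'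
  have hL : z (sysL p) = 0 := by
    have h : (croot ω₃ b - croot ω₃ b') * z (sysL p) = 0 := by rw [sub_mul, ← hK, ← hK', sub_self]
    exact (mul_eq_zero.mp h).resolve_left
      (sub_ne_zero.mpr fun h ↦ hbb (croot_injective isPrimitiveRoot_ω₃ h))
  have hK0 : z (sysK p) = 0 := by rw [hK, hL, mul_zero]
  -- the coordinates of `P` are those of the Eckardt point, scaled by `z_J`
  apply (isEmbedding_hypersurfacePoint ιX).injective
  rw [hypersurfacePoint_eckardt, ← Projectivization.mk_rep (hypersurfacePoint ιX P)]
  refine (Projectivization.mk_eq_mk_iff' ℂ _ _ _ _).mpr ⟨z (sysJ p), funext fun i ↦ ?_⟩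
  rw [Pi.smul_apply, smul_eq_mul]
  change z (sysJ p) * _ = z i
  obtain ⟨h1, -, -, -, -, -, hall⟩ := sys_facts p
  rcases hall i with rfl | rfl | rfl | rfl
  · rw [if_pos rfl, h0, mul_comm]
  · rw [if_neg h1.symm, if_pos rfl, mul_one]
  · have hK0' : (sysK p : Fin (2 * 1 + 2)) ≠ 0 := by cases p <;> decide
    have hKJ : (sysK p : Fin (2 * 1 + 2)) ≠ sysJ p := by cases p <;> decide
    rw [if_neg hK0', if_neg hKJ, mul_zero, hK0]
  · have hL0 : (sysL p : Fin (2 * 1 + 2)) ≠ 0 := by cases p <;> decide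
    have hLJ : (sysL p : Fin (2 * 1 + 2)) ≠ sysJ p := by cases p <;> decide
    rw [if_neg hL0, if_neg hLJ, mul_zero, hL]

/-- **Prop. 8.2.7 in Čech form holds for the three lines of a tritangent (Eckardt) plane**
(`hypothesisH_of_concurrent` at the Eckardt point). [cite: DeligneHodgeIII1974, Prop. 8.2.7] -/
theorem hypothesisH_eckardt (p : Sys) (a : ZMod 3) (x' : complexBetti X₃ (1 + 1))
    (hx' : ∀ j : Fin 3, complexBetti.map (lineEmb p a (j : ZMod 3)) (1 + 1) x' = 0) :
    ∃ V : Set (Motives.ComplexPoints X₃), IsOpen V ∧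
      {P | P.pt ∈ ⋃ j : Fin 3, Set.range (lineEmb p a (j : ZMod 3)).left.base} ⊆ V ∧
      singularCohomology.map ℂ ℂ (subsetIncl V) (1 + 1) x' = 0 := by
  refine hypothesisH_of_concurrent isSmoothProjective_X₃ (Y := fun _ ↦ Motives.projectiveSpace 1 ℂ)
    (fun _ ↦ isSmoothProjective_P1) (fun j : Fin 3 ↦ lineEmb p a (j : ZMod 3))
    (Motives.AlgPoints.map (lineEmb p a 0) (projPoint 1 (Projectivization.mk ℂ ![(1 : ℂ), 0] (by simp))))
    (fun j ↦ eckardt_pt_mem_range p a 0 _) (fun i j hij P hi hj ↦ ?_) one_ne_zero x' hx'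
  have hij' : ((i : Fin 3) : ZMod 3) ≠ (j : ZMod 3) := hij
  rw [eq_eckardt_of_mem_of_mem p a hij' P hi hj]
  exact eckardt_eq p a _ _

/-! ### The three line classes of a tritangent plane span the classes supported on it -/

/-- `H⁰(ℙ¹(ℂ); ℂ) = ℂ · 1`, so every Gysin image `g_* y`, `y ∈ H⁰`, is a multiple of `g_* 1`.
[cite: HatcherAT2002, §3.1 p. 199] -/
theorem complexGysin_mem_span_lineClass (p : Sys) (a b : ZMod 3)
    (y : complexBetti (Motives.projectiveSpace 1 ℂ) 0) :
    complexGysin μ isSmoothProjective_P1 isSmoothProjective_X₃ (lineEmb p a b)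
        (show 0 + 2 * (2 * 1) = 2 * 1 + 2 * 1 by ring) y ∈ ℂ ∙ lineClass μ p a b := by
  haveI := connectedSpace_complexPoints isSmoothProjective_P1
  letI := isSmoothProjective_P1.chartedSpace
  haveI := ChartedSpace.locallyPathConnectedSpace (H := EuclideanSpace ℝ (Fin (2 * 1)))
    (M := Motives.ComplexPoints (Motives.projectiveSpace 1 ℂ))
  haveI : PathConnectedSpace (Motives.ComplexPoints (Motives.projectiveSpace 1 ℂ)) :=
    pathConnectedSpace_iff_connectedSpace.2 inferInstance
  rw [singularCohomology.eq_smul_one ℂ y, map_smul, ← lineClass_eq]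
  exact Submodule.smul_mem _ _ (Submodule.mem_span_singleton_self _)

/-- **A class of `H²(X²₃(ℂ))` dying off the plane section `Π ∩ X = ℓ₀ ∪ ℓ₁ ∪ ℓ₂` is a linear
combination of the three line classes**: Deligne's Cor. 8.2.8 `⊆` for the family of the three
lines (`ker_restrictCompl_le_iSup_range_complexGysin_of_pullback`, its hypothesis supplied by
`hypothesisH_eckardt`), the Gysin sources being `H⁰(ℙ¹(ℂ)) = ℂ · 1`.
[cite: DeligneHodgeIII1974, Cor. 8.2.8] [cite: Hartshorne1977, V Prop. 1.4] -/
theorem exists_eq_sum_smul_lineClass (p : Sys) (a : ZMod 3) (x : complexBetti X₃ (2 * 1))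
    (hx : complexBetti.restrictCompl X₃
      (⋃ j : Fin 3, Set.range (lineEmb p a (j : ZMod 3)).left.base) (2 * 1) x = 0) :
    ∃ s : Fin 3 → ℂ, x = ∑ j, s j • lineClass μ p a (j : ZMod 3) := by
  have key := ker_restrictCompl_le_iSup_range_complexGysin_of_pullback μ isSmoothProjective_X₃
    (ι := Fin 3) (m := fun _ ↦ 1) (Y := fun _ ↦ Motives.projectiveSpace 1 ℂ)
    (fun _ ↦ isSmoothProjective_P1) (fun j : Fin 3 ↦ lineEmb p a (j : ZMod 3)) (b := 2 * 1) (q := 1 + 1)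
    (by norm_num) (hypothesisH_eckardt p a)
  have hmem := key (LinearMap.mem_ker.mpr hx)
  have hle : (⨆ (j : Fin 3) (a' : ℕ) (hab : a' + 2 * (2 * 1) = 2 * 1 + 2 * 1),
      LinearMap.range (complexGysin μ isSmoothProjective_P1 isSmoothProjective_X₃
        (lineEmb p a (j : ZMod 3)) hab)) ≤
      Submodule.span ℂ (Set.range fun j : Fin 3 ↦ lineClass μ p a (j : ZMod 3)) := by
    refine iSup_le fun j ↦ iSup_le fun a' ↦ iSup_le fun hab ↦ ?_
    obtain rfl : a' = 0 := by omega
    rintro _ ⟨y, rfl⟩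
    have hj : lineClass μ p a (j : ZMod 3) ∈ Set.range (fun j : Fin 3 ↦ lineClass μ p a (j : ZMod 3)) :=
      ⟨j, rfl⟩
    exact Submodule.span_mono (Set.singleton_subset_iff.mpr hj)
      (complexGysin_mem_span_lineClass μ p a _ y)
  exact (Submodule.mem_span_range_iff_exists_fun ℂ).mp (hle hmem) |>.imp fun s hs ↦ hs.symm

/-! ### The auxiliary embedding `X ↪ ℙ³ ↪ ℙ⁴` moving the tritangent plane to `{y₀ = 0}` -/


/-- The linear forms `(x₀ - α x_J, x₀, x₁, x₂, x₃)` of the linear embedding `ℙ³ ↪ ℙ⁴` under which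
the plane `x₀ = α x_J` becomes the coordinate hyperplane `y₀ = 0`. [cite: Hartshorne1977, II Example 7.1.1] -/
def planeSubst (p : Sys) (α : ℂ) : Fin (4 + 1) → MvPolynomial (Fin (3 + 1)) ℂ :=
  Fin.cons (X 0 - C α * X (sysJ p)) X

/-- The forms of `planeSubst` are linear. [folklore] -/
theorem isHomogeneous_planeSubst (p : Sys) (α : ℂ) (i : Fin (4 + 1)) :
    (planeSubst p α i).IsHomogeneous 1 := by
  refine Fin.cases ?_ (fun j ↦ ?_) i
  · rw [planeSubst, Fin.cons_zero]
    exact (isHomogeneous_X ℂ 0).sub (isHomogeneous_C_mul_X α _)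
  · rw [planeSubst, Fin.cons_succ]
    exact isHomogeneous_X ℂ j

/-- Every variable of `ℙ³` is hit by `planeSubst`. [folklore] -/
theorem exists_planeSubst_eq_X (p : Sys) (α : ℂ) (j : Fin (3 + 1)) : ∃ i, planeSubst p α i = X j :=
  ⟨j.succ, by rw [planeSubst, Fin.cons_succ]⟩

/-- The value of the new coordinate `y₀` at `z`: `z₀ - α z_J`. [folklore] -/
theorem aeval_planeSubst_zero (p : Sys) (α : ℂ) (z : Fin (3 + 1) → ℂ) :
    aeval z (planeSubst p α 0) = z 0 - α * z (sysJ p) := by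
  rw [planeSubst, Fin.cons_zero, map_sub, map_mul, aeval_C, aeval_X, aeval_X,
    Algebra.algebraMap_self, RingHom.id_apply]

/-- **The complex points of `X²₃` off the three lines of the plane `x₀ = α x_J` lie over the chart
`{y₀ ≠ 0}` of `ℙ⁴`** under `X ↪ ℙ³ ↪ ℙ⁴`: if `y₀ = x₀ - α x_J` vanishes at `P = [z] ∈ X(ℂ)` then
`z_K³ + z_L³ = -(z₀³ + z_J³) = -(α³ + 1) z_J³ = 0`, so `z_K = -ωᵉ z_L` for some `e` and `P` lies on
`ℓ_{p,a,e}` (`X ∩ Π = ℓ₀ ∪ ℓ₁ ∪ ℓ₂`). [cite: Hartshorne1977, V Ex. 4.16] -/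
theorem hypersurfacePoint_mem_stdChartSource_of_not_mem (p : Sys) (a : ZMod 3)
    (P : Motives.ComplexPoints X₃)
    (hP : P.pt ∉ ⋃ j : Fin 3, Set.range (lineEmb p a (j : ZMod 3)).left.base) :
    hypersurfacePoint (ιX ≫ ProjectiveSpace.linSubstMap (planeSubst p (croot ω₃ a))
        (isHomogeneous_planeSubst p _) (exists_planeSubst_eq_X p _)) P ∈
      Projectivization.stdChartSource 0 := by
  set z := (hypersurfacePoint ιX P).rep with hzdef
  have hz0 : z ≠ 0 := Projectivization.rep_nonzero _
  -- the coordinates of `P` in `ℙ⁴`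
  have hcoord : hypersurfacePoint (ιX ≫ ProjectiveSpace.linSubstMap (planeSubst p (croot ω₃ a))
      (isHomogeneous_planeSubst p _) (exists_planeSubst_eq_X p _)) P =
      Projectivization.mk ℂ (fun i ↦ aeval z (planeSubst p (croot ω₃ a) i))
        (ProjectiveSpace.linSubstVec_ne_zero _ (exists_planeSubst_eq_X p _) hz0) := by
    refine hypersurfacePoint_eq_of_projPoint_eq _ _ ?_
    rw [Motives.AlgPoints.map_comp_apply, ← projPoint_hypersurfacePoint ιX P,
      ← Projectivization.mk_rep (hypersurfacePoint ιX P)]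
    exact (Motives.map_linSubstMap_projPoint_mk _ _ _ z hz0).symm
  -- `F(z) = 0`
  have hF : ∑ i : Fin (2 * 1 + 2), z i ^ 3 = 0 := by
    have hmem := hypersurfacePoint_mem_projZeroLocus (ι := ιX) (isHomogeneous_fermatPolynomial (2 * 1) 3)
      (SmoothHypersurface.range_hypersurfaceι _) P
    have h := hmem (fermatPolynomial ℂ (2 * 1) 3) rfl
    rw [eval_fermatPolynomial] at h
    exact h
  rw [hcoord, Projectivization.mk_mem_stdChartSource_iff, aeval_planeSubst_zero]
  intro h0
  apply hP
  have h0' : z 0 = croot ω₃ a * z (sysJ p) := sub_eq_zero.mp h0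
  -- `z_K³ + z_L³ = 0`
  have hKL : z (sysK p) ^ 3 + z (sysL p) ^ 3 = 0 := by
    have hsum : ∑ i : Fin (2 * 1 + 2), z i ^ 3 = z 0 ^ 3 + z 1 ^ 3 + z 2 ^ 3 + z 3 ^ 3 :=
      Fin.sum_univ_four _
    have hα := croot_pow_three isPrimitiveRoot_ω₃ a
    rw [hsum, h0'] at hF
    revert hF
    cases p <;> simp only [sysJ, sysK, sysL] <;> intro hF
    · linear_combination hF - (z 1) ^ 3 * hα
    · linear_combination hF - (z 2) ^ 3 * hα
    · linear_combination hF - (z 3) ^ 3 * hα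
  obtain ⟨e, he⟩ := exists_eq_croot_mul_of_cube_add_cube_eq_zero hKL
  refine Set.mem_iUnion.mpr ⟨⟨e.val, e.val_lt⟩, ?_⟩
  have hcast : (((⟨e.val, e.val_lt⟩ : Fin 3) : ZMod 3)) = e := by
    apply Fin.ext
    rfl
  rw [hcast, pt_mem_range_lineEmb_iff]
  exact ⟨h0', he⟩

/-! ### Meeting lines: `g_{ℓ'}^* cl(ℓ) ≠ 0` -/

/-- **`g_{ℓ'}^* cl(ℓ) ≠ 0` for the meeting lines `ℓ = ℓ_{p,a,b}`, `ℓ' = ℓ_{p,a',b}`, `a' ≠ a`**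
(`ℓ · ℓ' = 1`, Hartshorne V Ex. 4.16 / Thm. 4.9), via the tritangent plane `Π : x₀ = -ωᵃ x_J`
containing `ℓ` (module docstring): a hyperplane-type class `h' = ι'^* r₀`, `r₀ ≠ 0 ∈ H²(ℙ⁴(ℂ))`,
dies off `Π ∩ X = ℓ ∪ ℓ₁ ∪ ℓ₂`, hence is `Σ s_j cl(ℓ_j)`; `ℓ'` is skew to `ℓ₁, ℓ₂`, so
`g_{ℓ'}^* h' = s • g_{ℓ'}^* cl(ℓ)`, and `g_{ℓ'}^* h' = (ℓ' ↪ ℙ⁴)^* r₀ ≠ 0`.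
[cite: Hartshorne1977, V Ex. 4.16 and V Prop. 1.4] [cite: DeligneHodgeIII1974, Cor. 8.2.8]
[cite: VoisinHodgeI2002, §7.1.2] -/
theorem map_lineEmb_lineClass_ne_zero (p : Sys) (a b a' : ZMod 3) (ha : a' ≠ a) :
    complexBetti.map (lineEmb p a' b) (2 * 1) (lineClass μ p a b) ≠ 0 := by
  -- a non-zero class `r₀ ∈ H²(ℙ⁴(ℂ); ℂ)`
  obtain ⟨r₀, hr₀⟩ : ∃ r₀ : complexBetti (Motives.projectiveSpace 4 ℂ) (2 * 1), r₀ ≠ 0 := by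
    have h1 := finrank_complexBetti_projectiveSpace_two_mul_eq_one 4 (p := 1) (by norm_num)
    by_contra hcon
    have h0 : ∀ x : complexBetti (Motives.projectiveSpace 4 ℂ) (2 * 1), x = 0 :=
      fun x ↦ not_not.mp fun hx ↦ hcon ⟨x, hx⟩
    haveI : Subsingleton (complexBetti (Motives.projectiveSpace 4 ℂ) (2 * 1)) :=
      ⟨fun x y ↦ by rw [h0 x, h0 y]⟩
    rw [Module.finrank_zero_of_subsingleton] at h1
    exact zero_ne_one h1
  -- the embedding `X ↪ ℙ³ ↪ ℙ⁴` and the class `h'`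
  set T := ProjectiveSpace.linSubstMap (planeSubst p (croot ω₃ a)) (isHomogeneous_planeSubst p _)
    (exists_planeSubst_eq_X p _) with hT
  haveI hTci : IsClosedImmersion T.left := ProjectiveSpace.isClosedImmersion_linSubstMap_left _ _ _
  set h' : complexBetti X₃ (2 * 1) := complexBetti.map (ιX ≫ T) (2 * 1) r₀ with hh'
  -- `h'` dies off the three lines of the plane
  have hsupp : complexBetti.restrictCompl X₃
      (⋃ j : Fin 3, Set.range (lineEmb p a (j : ZMod 3)).left.base) (2 * 1) h' = 0 :=
    restrictCompl_map_eq_zero_of_stdChartSource (ιX ≫ T) 0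
      (hypersurfacePoint_mem_stdChartSource_of_not_mem p a) (by norm_num) r₀
  obtain ⟨s, hs⟩ := exists_eq_sum_smul_lineClass μ p a h' hsupp
  -- restrict to `ℓ'`
  set φ := (complexBetti.map (lineEmb p a' b) (2 * 1)).hom with hφ
  have hφh : φ h' ≠ 0 := by
    haveI : IsClosedImmersion (lineEmb p a' b ≫ ιX ≫ T).left := by
      rw [Over.comp_left, Over.comp_left]
      infer_instance
    have hne := complexBetti_map_two_ne_zero_of_isClosedImmersion isSmoothProjective_P1 le_rfl
      (lineEmb p a' b ≫ ιX ≫ T) hr₀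
    rw [complexBetti.map_comp, ModuleCat.comp_apply] at hne
    exact hne
  have hφj : ∀ j : Fin 3, (j : ZMod 3) ≠ b → φ (lineClass μ p a (j : ZMod 3)) = 0 := by
    intro j hj
    exact map_lineEmb_lineClass_eq_zero μ (fermatPlane_inf_eq_bot p
      (fun h ↦ ha (croot_injective isPrimitiveRoot_ω₃ h).symm)
      (fun h ↦ hj (croot_injective isPrimitiveRoot_ω₃ h)))
  have hsum : φ h' = s ⟨b.val, b.val_lt⟩ • φ (lineClass μ p a b) := by
    have hcast : (((⟨b.val, b.val_lt⟩ : Fin 3) : ZMod 3)) = b := Fin.ext rfl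
    rw [hs, map_sum, Finset.sum_eq_single (⟨b.val, b.val_lt⟩ : Fin 3)]
    · rw [map_smul, hcast]
    · intro j _ hjb
      rw [map_smul, hφj j (fun h ↦ hjb (Fin.ext (by rw [← h]; rfl))), smul_zero]
    · intro h
      exact absurd (Finset.mem_univ _) h
  intro h0
  apply hφh
  rw [hsum, show φ (lineClass μ p a b) = complexBetti.map (lineEmb p a' b) (2 * 1) (lineClass μ p a b)
    from rfl, h0, smul_zero]

end Lines

end Literature.AlgebraicGeometry.HodgeTheory

end
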